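import Mathlib
import HarnessLib
import Literature.NumberTheory.Sieve.PrimeDivisorsOfPolynomials

/-!
# Every number field has infinitely many primes of residue degree one (elementary)

Topic `Literature/NumberTheory/NumberFields`.  For a number field `K` and every bound `N` there is
a rational prime `p > N` together with a ring homomorphism `𝓞 K →+* ZMod p`, i.e. a prime ideal
of `𝓞 K` with residue field `𝔽_p` (residue degree one).  The classical proof via the Dedekind
zeta function (degree-one primes have Dirichlet density `1`) is replaced here by the elementary
argument: let `θ` be an integral primitive element, `g = minpoly_ℤ(θ)` and `m ≠ 0` an integer with
`m · 𝓞 K ⊆ ℤ[θ]` (a discriminant: `Algebra.discr_mul_isIntegral_mem_adjoin`); by Schur's theorem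
(`Literature.NumberTheory.Sieve.schur_exists_prime_dvd_eval`) there are arbitrarily large primes
`p ∤ m` with `p ∣ g(a)` for some `a ∈ ℤ`; evaluation `θ ↦ a` is a ring map `φ₀ : ℤ[θ] → 𝔽_p`
(`ℤ[θ] ≅ ℤ[X]/(g)`, `minpoly.equivAdjoin`), and `z ↦ m̄⁻¹ · φ₀(m z)` extends it to `𝓞 K`.

* `exists_int_mul_mem_adjoin` — an integral primitive `θ` and `m ≠ 0` with `m · 𝓞_K ⊆ ℤ[θ]`;
* `nonempty_ringHom_zmod_of_dvd_eval` — `p ∤ m`, `p ∣ g(a)` ⇒ a ring map `𝓞 K →+* ZMod p`;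
* `exists_prime_gt_nonempty_ringHom_zmod` — for every `N` a prime `p > N` with `𝓞 K →+* ZMod p`.

(Used by the trace-zero parabola lifts of `Summits/…/LevelOneGL2Designs`: Pohoata's
Proposition 5.1 needs primes with a degree-one prime of a totally real field above them.)

## References
* J. Neukirch, *Algebraic Number Theory*, Ch. I §8 (Dedekind–Kummer; primes of degree one),
  and I. Schur (1912) for the prime divisors of polynomials. [folklore]
-/

namespace Literature.NumberTheory.NumberFields

open NumberField Polynomial
open scoped IntermediateField

variable (K : Type*) [Field K] [NumberField K]

/-- A number field has an integral primitive element `θ` and a non-zero integer `m` with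
`m · z ∈ ℤ[θ]` for every algebraic integer `z` (take `m` = the discriminant of the power basis
`1, θ, …, θ^{d-1}` of `K/ℚ`). [folklore] -/
theorem exists_int_mul_mem_adjoin :
    ∃ θ : K, IsIntegral ℤ θ ∧ ∃ m : ℤ, m ≠ 0 ∧
      ∀ z : K, IsIntegral ℤ z → (m : K) * z ∈ Algebra.adjoin ℤ ({θ} : Set K) := by
  classical
  obtain ⟨α, hα⟩ := Field.exists_primitive_element ℚ K
  obtain ⟨y, hy0, hθint⟩ :=
    ((IsFractionRing.isAlgebraic_iff ℤ ℚ K).mpr (Algebra.IsAlgebraic.isAlgebraic (R := ℚ) α)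
      ).exists_integral_multiple
  set θ : K := y • α with hθdef
  have hθtop : ℚ⟮θ⟯ = ⊤ := by
    rw [eq_top_iff, ← hα, IntermediateField.adjoin_simple_le_iff]
    have hy : (y : K) ≠ 0 := by exact_mod_cast hy0
    have : α = (y : K)⁻¹ * θ := by
      rw [hθdef, zsmul_eq_mul, ← mul_assoc, inv_mul_cancel₀ hy, one_mul]
    rw [this]
    exact mul_mem (inv_mem (intCast_mem _ y)) (IntermediateField.mem_adjoin_simple_self ℚ θ)
  have hθQ : IsIntegral ℚ θ := hθint.tower_top
  let pb₀ : PowerBasis ℚ ℚ⟮θ⟯ := IntermediateField.adjoin.powerBasis hθQ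
  let e : ℚ⟮θ⟯ ≃ₐ[ℚ] K := (IntermediateField.equivOfEq hθtop).trans IntermediateField.topEquiv
  let pb : PowerBasis ℚ K := pb₀.map e
  have hgen : pb.gen = θ := by
    simp only [pb, pb₀, e, PowerBasis.map_gen, IntermediateField.adjoin.powerBasis_gen]
    rfl
  have hint : IsIntegral ℤ pb.gen := hgen ▸ hθint
  have hbint : ∀ i, IsIntegral ℤ (pb.basis i) := fun i => by
    rw [pb.basis_eq_pow i]; exact hint.pow _
  have hdint : IsIntegral ℤ (Algebra.discr ℚ pb.basis) := Algebra.discr_isIntegral ℚ hbint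
  obtain ⟨m, hm⟩ := IsIntegrallyClosed.isIntegral_iff.mp hdint
  have hd0 : Algebra.discr ℚ pb.basis ≠ 0 := Algebra.discr_not_zero_of_basis ℚ pb.basis
  refine ⟨θ, hθint, m, ?_, fun z hz => ?_⟩
  · rintro rfl
    apply hd0
    rw [← hm, map_zero]
  · have h := Algebra.discr_mul_isIntegral_mem_adjoin (R := ℤ) (K := ℚ) (B := pb) hint hz
    rw [hgen] at h
    have hmK : Algebra.discr ℚ pb.basis • z = (m : K) * z := by
      rw [Algebra.smul_def, ← hm, eq_intCast, map_intCast]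
    rwa [hmK] at h

/-- If `θ` is an algebraic integer of `K`, `m ≠ 0` an integer with `m · 𝓞_K ⊆ ℤ[θ]`, `p ∤ m` a
prime and `a ∈ ℤ` with `p ∣ minpoly_ℤ(θ)(a)`, then there is a ring homomorphism `𝓞 K → ZMod p`
(namely `z ↦ m̄⁻¹ · φ₀(m z)` where `φ₀ : ℤ[θ] ≅ ℤ[X]/(minpoly) → 𝔽_p` is evaluation at `a`).
[folklore] -/
theorem nonempty_ringHom_zmod_of_dvd_eval {θ : K} (hθ : IsIntegral ℤ θ) {m : ℤ}
    (hm : ∀ z : K, IsIntegral ℤ z → (m : K) * z ∈ Algebra.adjoin ℤ ({θ} : Set K))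
    {p : ℕ} [Fact p.Prime] (hpm : ¬ (p : ℤ) ∣ m) {a : ℤ}
    (hpa : (p : ℤ) ∣ (minpoly ℤ θ).eval a) : Nonempty (𝓞 K →+* ZMod p) := by
  classical
  -- evaluation at `a` kills the minimal polynomial modulo `p`
  have hroot : (minpoly ℤ θ).eval₂ (Int.castRingHom (ZMod p)) (a : ZMod p) = 0 := by
    have ha : (a : ZMod p) = Int.castRingHom (ZMod p) a := rfl
    rw [ha, Polynomial.eval₂_at_apply, eq_intCast, ZMod.intCast_zmod_eq_zero_iff_dvd]
    exact hpa
  let φ₀ : Algebra.adjoin ℤ ({θ} : Set K) →+* ZMod p :=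
    (AdjoinRoot.lift (Int.castRingHom (ZMod p)) (a : ZMod p) hroot).comp
      (minpoly.equivAdjoin hθ).symm.toRingEquiv.toRingHom
  have hmbar : ((m : ℤ) : ZMod p) ≠ 0 := fun h =>
    hpm ((ZMod.intCast_zmod_eq_zero_iff_dvd m p).mp h)
  -- `ι z = m·z ∈ ℤ[θ]`
  let ι : 𝓞 K → Algebra.adjoin ℤ ({θ} : Set K) := fun z =>
    ⟨(m : K) * z, hm z (RingOfIntegers.isIntegral_coe z)⟩
  have hι_coe : ∀ z : 𝓞 K, ((ι z : Algebra.adjoin ℤ ({θ} : Set K)) : K) = (m : K) * z :=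
    fun z => rfl
  have hmcoe : ((m : Algebra.adjoin ℤ ({θ} : Set K)) : K) = (m : K) := by
    rw [← zsmul_one, Subalgebra.coe_smul, Subalgebra.coe_one, zsmul_one]
  have hι_one : ι 1 = (m : Algebra.adjoin ℤ ({θ} : Set K)) :=
    Subtype.ext (by rw [hι_coe, hmcoe, RingOfIntegers.coe_eq_algebraMap, map_one, mul_one])
  have hι_mul : ∀ z w : 𝓞 K, ι z * ι w = ι (z * w) * (m : Algebra.adjoin ℤ ({θ} : Set K)) :=
    fun z w => Subtype.ext (by
      simp only [Subalgebra.coe_mul, hι_coe, hmcoe, RingOfIntegers.coe_eq_algebraMap, map_mul]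
      ring)
  have hι_add : ∀ z w : 𝓞 K, ι (z + w) = ι z + ι w := fun z w => Subtype.ext (by
    simp only [Subalgebra.coe_add, hι_coe, RingOfIntegers.coe_eq_algebraMap, map_add]
    ring)
  have hι_zero : ι 0 = 0 := Subtype.ext (by
    rw [hι_coe, Subalgebra.coe_zero, RingOfIntegers.coe_eq_algebraMap, map_zero, mul_zero])
  refine ⟨{ toFun := fun z => ((m : ℤ) : ZMod p)⁻¹ * φ₀ (ι z)
            map_one' := ?_, map_mul' := ?_, map_zero' := ?_, map_add' := ?_ }⟩
  · rw [hι_one, map_intCast, inv_mul_cancel₀ hmbar]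
  · intro z w
    have key : φ₀ (ι z) * φ₀ (ι w) = φ₀ (ι (z * w)) * (m : ZMod p) := by
      rw [← map_mul, hι_mul, map_mul, map_intCast]
    calc ((m : ℤ) : ZMod p)⁻¹ * φ₀ (ι (z * w))
        = ((m : ℤ) : ZMod p)⁻¹ * ((m : ℤ) : ZMod p)⁻¹ * (φ₀ (ι (z * w)) * (m : ZMod p)) := by
          field_simp
      _ = ((m : ℤ) : ZMod p)⁻¹ * φ₀ (ι z) * (((m : ℤ) : ZMod p)⁻¹ * φ₀ (ι w)) := by
          rw [← key]; ring
  · rw [hι_zero, map_zero, mul_zero]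
  · intro z w
    rw [hι_add, map_add, mul_add]

/-- **Infinitely many primes of residue degree one** (elementary form): for every number field `K`
and every `N` there is a prime `p > N` together with a ring homomorphism `𝓞 K →+* ZMod p`,
i.e. a prime of `K` above `p` with residue field `𝔽_p`. [folklore] -/
theorem exists_prime_gt_nonempty_ringHom_zmod (N : ℕ) :
    ∃ p : ℕ, p.Prime ∧ N < p ∧ Nonempty (𝓞 K →+* ZMod p) := by
  obtain ⟨θ, hθ, m, hm0, hm⟩ := exists_int_mul_mem_adjoin K
  obtain ⟨p, hp, hNp, a, hpa⟩ := Literature.NumberTheory.Sieve.schur_exists_prime_dvd_eval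
    (minpoly ℤ θ) (minpoly.natDegree_pos hθ) (N + m.natAbs)
  haveI := Fact.mk hp
  refine ⟨p, hp, by omega, nonempty_ringHom_zmod_of_dvd_eval K hθ hm ?_ hpa⟩
  intro hdvd
  have h1 : p ∣ m.natAbs := Int.ofNat_dvd_left.mp hdvd
  have h2 : p ≤ m.natAbs := Nat.le_of_dvd (Int.natAbs_pos.mpr hm0) h1
  omega

end Literature.NumberTheory.NumberFields
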